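import Summits.QuantumAdvantage.QuantumAdvantage.Theorems.ArithStatLadderIqThreeNotPPolyStubApSieve
import Summits.QuantumAdvantage.QuantumAdvantage.Theorems.ArithStatLadderIqThreeNotPPolyStubFundDensityAP
import HarnessLib

/-!
# Stub `stub_cubeDensity` of line `Sketch` (v3) for the crux `ArithStatLadder.IqThreeNotBPP`

YES-density of the planted cube sampler. For an odd `M < 2ⁿ` put `T := 2^(3n+32)`,
`K := 2^(6n+60)` (so `T² = 16 K`), `U := 6 M T ∓ 1` (the sign `−` exactly when `M ≡ 2 (mod 3)`),
and for a seed `j < K` put `s := 1 + 6 M U j`, `w := 2U³ − M s`. At least `K / 4` of the seeds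
have `M s ≤ U³` and both `s` and `w` squarefree. The only number theory used is the LANDED
elementary squarefree sieve in an arithmetic progression `stub_apSieve` (crux 2422), at `p₀ = 5`
(primes not dividing a multiple of `6` are `≥ 5`: the landed `fundAP_five_le`).

Mathematics.
* Sizes (`cubeD_sizes`): `U ≥ 5 M T`, so `U³ ≥ 25 M² T² U = 400 M² K U ≥ M + 6 M² U K`; hence
  `M s ≤ U³` for EVERY `j < K` and `w ≥ U³ > 0`. Also `U ≤ 6 · 2ⁿ T`, whence
  `√(1 + 6 M U K) ≤ 2^(6n+49) = K / 2048` and `√(2U³ + 6M²U) ≤ √(3U³) ≤ 2^(6n+53) = K / 128`.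
* Progression 1: `s_j = 1 + (6 M U) j`, `gcd(1, 6MU) = 1`, primes not dividing `6 M U` are `≥ 5`:
  `4 · #{j < K : s_j not squarefree} ≤ K + 4 √(1 + 6 M U K)`.
* Progression 2, reflected (`cubeD_card_reflect`, `j ↦ K − 1 − j`): `w_j = a + (6 M² U)(K − 1 − j)`
  with `a := 2U³ − M − 6M²U (K − 1) > 0`, and `gcd(a, 6 M² U) = 1` (`cubeD_coprime`: `a` is odd as
  `M` is odd; `a ≡ 2U³ − M ≢ 0 (mod 3)` by the choice of the sign; a common prime of `a` and `M`
  divides `2U³`, of `a` and `U` divides `M`, but `gcd(U, M) = 1` and `M` is odd):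
  `4 · #{j < K : w_j not squarefree} ≤ K + 4 √(a + 6M²U K) ≤ K + 4 √(2U³ + 6M²U)`.
* Covering (`cubeD_le_card_add`): `K ≤ good + bad₁ + bad₂`, so
  `4 · good ≥ 4K − 2K − 4√· − 4√· ≥ 2K − K/512 − K/32 ≥ K`. We take `n₀ := 0`.
-/

set_option linter.dupNamespace false -- D-0017: single-problem summit ⇒ QuantumAdvantage.QuantumAdvantage by design

namespace Summit.QuantumAdvantage.QuantumAdvantage.Theorems.IqThreeNotBPP

open Finset
open Summit.QuantumAdvantage.QuantumAdvantage.Theorems.IqThreeNotPPoly (stub_apSieve fundAP_five_le)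

/-! ## Elementary helpers -/

/-- Covering bound: if `A k` holds for every `k < K`, then `range K ⊆ {A ∧ B ∧ C} ∪ {¬B} ∪ {¬C}`,
so `K ≤ #{A ∧ B ∧ C} + #{¬B} + #{¬C}`. [folklore] -/
theorem cubeD_le_card_add {K : ℕ} {A B C : ℕ → Prop} [DecidablePred A] [DecidablePred B]
    [DecidablePred C] (hA : ∀ k, k < K → A k) :
    K ≤ ((Finset.range K).filter (fun k => A k ∧ B k ∧ C k)).card +
      ((Finset.range K).filter (fun k => ¬ B k)).card +
      ((Finset.range K).filter (fun k => ¬ C k)).card := by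
  calc K = (Finset.range K).card := (Finset.card_range K).symm
    _ ≤ ((Finset.range K).filter (fun k => A k ∧ B k ∧ C k) ∪
          (Finset.range K).filter (fun k => ¬ B k) ∪
          (Finset.range K).filter (fun k => ¬ C k)).card := by
        apply Finset.card_le_card
        intro k hk
        have hkK : k < K := Finset.mem_range.mp hk
        simp only [Finset.mem_union, Finset.mem_filter]
        by_cases hB : B k
        · by_cases hC : C k
          · exact Or.inl (Or.inl ⟨hk, hA k hkK, hB, hC⟩)
          · exact Or.inr ⟨hk, hC⟩
        · exact Or.inl (Or.inr ⟨hk, hB⟩)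
    _ ≤ _ := (Finset.card_union_le _ _).trans
          (Nat.add_le_add_right (Finset.card_union_le _ _) _)

/-- Reflection `j ↦ K − 1 − j` of `range K`: if `P j → Q (K − 1 − j)` for `j < K`, then
`#{j < K : P j} ≤ #{i < K : Q i}`. [folklore] -/
theorem cubeD_card_reflect {K : ℕ} {P Q : ℕ → Prop} [DecidablePred P] [DecidablePred Q]
    (h : ∀ j, j < K → P j → Q (K - 1 - j)) :
    ((Finset.range K).filter P).card ≤ ((Finset.range K).filter Q).card := by
  refine Finset.card_le_card_of_injOn (fun j => K - 1 - j) ?_ ?_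
  · intro j hj
    have hj' := Finset.mem_filter.mp (Finset.mem_coe.mp hj)
    have hjK : j < K := Finset.mem_range.mp hj'.1
    have hlt : K - 1 - j < K := by omega
    exact Finset.mem_coe.mpr (Finset.mem_filter.mpr ⟨Finset.mem_range.mpr hlt, h j hjK hj'.2⟩)
  · intro j₁ hj₁ j₂ hj₂ heq
    have h1 : j₁ < K := Finset.mem_range.mp (Finset.mem_filter.mp (Finset.mem_coe.mp hj₁)).1
    have h2 : j₂ < K := Finset.mem_range.mp (Finset.mem_filter.mp (Finset.mem_coe.mp hj₂)).1
    have heq' : K - 1 - j₁ = K - 1 - j₂ := heq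
    omega

/-- `(2 U³) mod 3` only depends on `U mod 3`. [folklore] -/
theorem cubeD_two_cube_mod_three (U : ℕ) : (2 * U ^ 3) % 3 = (2 * (U % 3) ^ 3) % 3 :=
  ((Nat.mod_modEq U 3).symm.pow 3).mul_left 2

/-! ## Coprimality of the reflected progression -/

/-- Coprimality of the reflected second progression: if `M` is odd, `gcd(U, M) = 1`,
`2U³ ≢ M (mod 3)` and `a + M + 6M²U·r = 2U³`, then `gcd(a, 6M²U) = 1` (`a` is odd, `3 ∤ a`,
a common prime of `a` and `M` divides `2U³`, a common prime of `a` and `U` divides `M`). -/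
theorem cubeD_coprime {M U a r : ℕ} (hM2 : M % 2 = 1)
    (hU3 : (2 * U ^ 3) % 3 ≠ M % 3) (hUM : Nat.Coprime U M)
    (ha : a + M + M * (6 * M * U) * r = 2 * U ^ 3) :
    Nat.Coprime a (M * (6 * M * U)) := by
  have hev : M * (6 * M * U) * r = 6 * (M * M * U * r) := by ring
  have ha2 : ¬ 2 ∣ a := by omega
  have ha3 : ¬ 3 ∣ a := by omega
  have h2 : Nat.Coprime a 2 := ((Nat.Prime.coprime_iff_not_dvd Nat.prime_two).2 ha2).symm
  have h3 : Nat.Coprime a 3 := ((Nat.Prime.coprime_iff_not_dvd Nat.prime_three).2 ha3).symm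
  have h2U : Nat.Coprime (2 * U ^ 3) M :=
    Nat.Coprime.mul_left ((Nat.Prime.coprime_iff_not_dvd Nat.prime_two).2 (by omega))
      (hUM.pow_left 3)
  have hM : Nat.Coprime a M := by
    apply Nat.coprime_of_dvd
    intro p hp hpa hpM
    have h1 : p ∣ a + M + M * (6 * M * U) * r :=
      dvd_add (dvd_add hpa hpM) (dvd_mul_of_dvd_left (dvd_mul_of_dvd_left hpM _) _)
    rw [ha] at h1
    have h4 := Nat.dvd_gcd h1 hpM
    rw [h2U.gcd_eq_one] at h4
    exact hp.not_dvd_one h4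
  have hU : Nat.Coprime a U := by
    apply Nat.coprime_of_dvd
    intro p hp hpa hpU
    have h1 : p ∣ 2 * U ^ 3 := dvd_mul_of_dvd_right (dvd_pow hpU (by norm_num)) 2
    have h5 : p ∣ M * (6 * M * U) * r :=
      dvd_mul_of_dvd_left (dvd_mul_of_dvd_right (dvd_mul_of_dvd_right hpU _) _) _
    have h6 : p ∣ M := by
      have h4 : M = 2 * U ^ 3 - a - M * (6 * M * U) * r := by omega
      rw [h4]
      exact Nat.dvd_sub (Nat.dvd_sub h1 hpa) h5
    have h7 := Nat.dvd_gcd hpU h6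
    rw [hUM.gcd_eq_one] at h7
    exact hp.not_dvd_one h7
  have h6 : Nat.Coprime a 6 := by
    rw [show (6 : ℕ) = 2 * 3 from rfl]
    exact h2.mul_right h3
  exact hM.mul_right ((h6.mul_right hM).mul_right hU)

/-! ## Sizes -/

/-- Power-of-two bookkeeping: for `1 ≤ M < 2ⁿ` and `5 M T ≤ U ≤ 6 M T + 1`, `T = 2^(3n+32)`,
`K = 2^(6n+60)`: `M + 6M²U K ≤ U³` and `4√(1 + 6MUK) + 4√(2U³ + 6M²U) ≤ K`. -/
theorem cubeD_sizes {n M U : ℕ} (hM1 : 1 ≤ M) (hMn : M < 2 ^ n)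
    (hUlo : 5 * (M * 2 ^ (3 * n + 32)) ≤ U) (hUhi : U ≤ 6 * (M * 2 ^ (3 * n + 32)) + 1) :
    M + M * (6 * M * U) * 2 ^ (6 * n + 60) ≤ U ^ 3 ∧
    4 * Nat.sqrt (1 + 6 * M * U * 2 ^ (6 * n + 60)) +
      4 * Nat.sqrt (2 * U ^ 3 + M * (6 * M * U)) ≤ 2 ^ (6 * n + 60) := by
  obtain ⟨T, hT⟩ : ∃ T, T = 2 ^ (3 * n + 32) := ⟨_, rfl⟩
  obtain ⟨K, hK⟩ : ∃ K, K = 2 ^ (6 * n + 60) := ⟨_, rfl⟩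
  have hTK : T ^ 2 = 16 * K := by rw [hT, hK, ← pow_mul]; ring
  have hR₁ : K = 2048 * 2 ^ (6 * n + 49) := by rw [hK]; ring
  have hR₂ : K = 128 * 2 ^ (6 * n + 53) := by rw [hK]; ring
  rw [← hT] at hUlo hUhi
  rw [← hK]
  have hT1 : 1 ≤ T := hT ▸ Nat.one_le_two_pow
  have hK1 : 1 ≤ K := hK ▸ Nat.one_le_two_pow
  have hU1 : 1 ≤ U := le_trans (by nlinarith) hUlo
  have hU' : U ≤ 6 * (2 ^ n * T) := by
    have h : (M + 1) * T ≤ 2 ^ n * T := Nat.mul_le_mul_right T hMn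
    nlinarith [hUhi, hT1, h]
  refine ⟨?_, ?_⟩
  · -- `M + 6M²UK ≤ 400 M²UK = (5MT)² U ≤ U³`
    have h1 : (5 * (M * T)) ^ 2 * U ≤ U ^ 2 * U :=
      Nat.mul_le_mul_right U (Nat.pow_le_pow_left hUlo 2)
    have h2 : M ≤ M * (M * U * K) :=
      Nat.le_mul_of_pos_right M (Nat.mul_pos (Nat.mul_pos hM1 hU1) hK1)
    have h3 : (5 * (M * T)) ^ 2 * U = 400 * (M * (M * U * K)) := by
      rw [mul_pow, mul_pow, hTK]; ring
    nlinarith [h1, h2, h3]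
  · have hs1 : Nat.sqrt (1 + 6 * M * U * K) ≤ 2 ^ (6 * n + 49) := by
      rw [← Nat.sqrt_eq' (2 ^ (6 * n + 49))]
      apply Nat.sqrt_le_sqrt
      have h1 : 6 * M * U * K ≤ 6 * 2 ^ n * (6 * (2 ^ n * T)) * K :=
        Nat.mul_le_mul (Nat.mul_le_mul (Nat.mul_le_mul_left 6 hMn.le) hU') le_rfl
      have h2 : 2 ^ n * 2 ^ n * T * K = 2 ^ (11 * n + 92) := by rw [hT, hK]; ring
      have h3 : (2 ^ (6 * n + 49)) ^ 2 = 2 ^ (n + 6) * 2 ^ (11 * n + 92) := by ring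
      have h4 : 64 ≤ 2 ^ (n + 6) :=
        calc (64 : ℕ) = 2 ^ 6 := by norm_num
          _ ≤ 2 ^ (n + 6) := Nat.pow_le_pow_right (by norm_num) (by omega)
      have hX : 1 ≤ 2 ^ (11 * n + 92) := Nat.one_le_two_pow
      have h5 : 64 * 2 ^ (11 * n + 92) ≤ 2 ^ (n + 6) * 2 ^ (11 * n + 92) :=
        Nat.mul_le_mul_right _ h4
      rw [h3]
      nlinarith [h1, h2, h5, hX]
    have hs2 : Nat.sqrt (2 * U ^ 3 + M * (6 * M * U)) ≤ 2 ^ (6 * n + 53) := by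
      rw [← Nat.sqrt_eq' (2 ^ (6 * n + 53))]
      apply Nat.sqrt_le_sqrt
      have h5 : 5 * M ≤ U := le_trans (by nlinarith [hT1]) hUlo
      have h6 : M * (6 * M * U) ≤ U ^ 3 := by
        calc M * (6 * M * U) = 6 * M * M * U := by ring
          _ ≤ 5 * M * (5 * M) * U := Nat.mul_le_mul_right U (by nlinarith)
          _ ≤ U * U * U := Nat.mul_le_mul (Nat.mul_le_mul h5 h5) le_rfl
          _ = U ^ 3 := by ring
      have h7 : U ^ 3 ≤ (6 * (2 ^ n * T)) ^ 3 := Nat.pow_le_pow_left hU' 3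
      have h8 : (6 * (2 ^ n * T)) ^ 3 = 216 * 2 ^ (12 * n + 96) := by rw [hT]; ring
      have h9 : (2 ^ (6 * n + 53)) ^ 2 = 1024 * 2 ^ (12 * n + 96) := by ring
      rw [h9]
      nlinarith [h6, h7, h8]
    omega

/-! ## Counting -/

/-- The counting core: for odd `M`, `U` with `gcd(U, M) = 1`, `2U³ ≢ M (mod 3)`, the size bound
`M + 6M²U K ≤ U³` and the error bound `4√(1 + 6MUK) + 4√(2U³ + 6M²U) ≤ K`, at least `K / 4` of the
`j < K` have `M s ≤ U³`, `s` and `2U³ − M s` squarefree, `s = 1 + 6MU j` (two instances of the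
landed AP sieve `stub_apSieve` at `p₀ = 5`, the second one after the reflection `j ↦ K − 1 − j`). -/
theorem cubeD_count {M U K : ℕ} (hK : 0 < K) (hM2 : M % 2 = 1) (hU2 : U % 2 = 1)
    (hU3 : (2 * U ^ 3) % 3 ≠ M % 3) (hUM : Nat.Coprime U M)
    (hbig : M + M * (6 * M * U) * K ≤ U ^ 3)
    (hsqrt : 4 * Nat.sqrt (1 + 6 * M * U * K) +
      4 * Nat.sqrt (2 * U ^ 3 + M * (6 * M * U)) ≤ K) :
    K ≤ 4 * ((Finset.range K).filter (fun j =>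
        M * (1 + 6 * M * U * j) ≤ U ^ 3 ∧ Squarefree (1 + 6 * M * U * j) ∧
          Squarefree (2 * U ^ 3 - M * (1 + 6 * M * U * j)))).card := by
  have hM0 : 0 < M := by omega
  have hU0 : 0 < U := by omega
  -- the second progression, reflected: modulus `q`, first term `a`
  obtain ⟨q, hq⟩ : ∃ q, q = M * (6 * M * U) := ⟨_, rfl⟩
  obtain ⟨a, ha⟩ : ∃ a, a = 2 * U ^ 3 - (M + q * (K - 1)) := ⟨_, rfl⟩
  have h6MU : 0 < 6 * M * U := Nat.mul_pos (Nat.mul_pos (by norm_num) hM0) hU0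
  have hq0 : 0 < q := hq ▸ Nat.mul_pos hM0 h6MU
  have hqK : q * (K - 1) + q = q * K := by
    conv_rhs => rw [← Nat.sub_add_cancel (show 1 ≤ K from hK), Nat.mul_add, Nat.mul_one]
  rw [← hq] at hbig hsqrt
  have ha' : a + M + q * (K - 1) = 2 * U ^ 3 := by omega
  have hms : ∀ j, M * (1 + 6 * M * U * j) = M + q * j := fun j => by rw [hq]; ring
  -- coprimality and the prime condition
  have hcop : Nat.Coprime a q := by
    rw [hq]
    exact cubeD_coprime (r := K - 1) hM2 hU3 hUM (by rw [← hq]; exact ha')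
  have h6q : 6 ∣ q := ⟨M * (M * U), by rw [hq]; ring⟩
  have h6q₁ : 6 ∣ 6 * M * U := ⟨M * U, by ring⟩
  -- sieve, progression 1
  have hS1 : (5 - 1) * ((Finset.range K).filter
        (fun k => ¬ Squarefree (1 + 6 * M * U * k))).card ≤
      K + (5 - 1) * Nat.sqrt (1 + 6 * M * U * K) :=
    stub_apSieve 1 (6 * M * U) K 5 h6MU (Nat.coprime_one_left _) (by norm_num)
      (fun p hp hpn => fundAP_five_le hp h6q₁ hpn)
  -- sieve, progression 2 (reflected)
  have hS2 : (5 - 1) * ((Finset.range K).filter (fun k => ¬ Squarefree (a + q * k))).card ≤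
      K + (5 - 1) * Nat.sqrt (a + q * K) :=
    stub_apSieve a q K 5 hq0 hcop (by norm_num) (fun p hp hpn => fundAP_five_le hp h6q hpn)
  have hs2 : Nat.sqrt (a + q * K) ≤ Nat.sqrt (2 * U ^ 3 + q) := Nat.sqrt_le_sqrt (by omega)
  -- reflection `j ↦ K - 1 - j`
  have hrefl : ((Finset.range K).filter
        (fun j => ¬ Squarefree (2 * U ^ 3 - M * (1 + 6 * M * U * j)))).card ≤
      ((Finset.range K).filter (fun k => ¬ Squarefree (a + q * k))).card := by
    refine cubeD_card_reflect fun j hj hP => ?_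
    have e2 : q * (K - 1) = q * j + q * (K - 1 - j) := by
      rw [← Nat.mul_add]; congr 1; omega
    have e : a + q * (K - 1 - j) = 2 * U ^ 3 - M * (1 + 6 * M * U * j) := by
      rw [hms]; omega
    show ¬ Squarefree (a + q * (K - 1 - j))
    rw [e]
    exact hP
  -- covering (the size condition holds for every seed)
  have hcov : K ≤ ((Finset.range K).filter (fun j =>
        M * (1 + 6 * M * U * j) ≤ U ^ 3 ∧ Squarefree (1 + 6 * M * U * j) ∧
          Squarefree (2 * U ^ 3 - M * (1 + 6 * M * U * j)))).card +
      ((Finset.range K).filter (fun j => ¬ Squarefree (1 + 6 * M * U * j))).card +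
      ((Finset.range K).filter
        (fun j => ¬ Squarefree (2 * U ^ 3 - M * (1 + 6 * M * U * j)))).card :=
    cubeD_le_card_add fun j hj => by
      show M * (1 + 6 * M * U * j) ≤ U ^ 3
      rw [hms]
      have : q * j ≤ q * K := Nat.mul_le_mul_left q hj.le
      omega
  omega

/-! ## The stub -/

/-- The stub with the `let` unfolded into an equation `hU`: for odd `M < 2ⁿ` and
`U = 6M·2^(3n+32) ∓ 1` (sign `−` iff `M ≡ 2 (mod 3)`), at least a quarter of the seeds
`j < 2^(6n+60)` are good (verifies the hypotheses of `cubeD_count` via `cubeD_sizes`: `U` is odd,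
`5M·2^(3n+32) ≤ U ≤ 6M·2^(3n+32) + 1`, `gcd(U, M) = 1` as `U ≡ ±1 (mod M)`, and
`2U³ mod 3 = 1 ≠ 2 = M mod 3` resp. `2U³ mod 3 = 2 ≠ M mod 3` by the choice of the sign). -/
theorem cubeD_density_of_eq (n M U : ℕ) (hM : Odd M) (hMn : M < 2 ^ n)
    (hU : U = if M % 3 = 2 then 6 * M * 2 ^ (3 * n + 32) - 1 else 6 * M * 2 ^ (3 * n + 32) + 1) :
    2 ^ (6 * n + 60) ≤ 4 * ((Finset.range (2 ^ (6 * n + 60))).filter (fun j =>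
      M * (1 + 6 * M * U * j) ≤ U ^ 3 ∧ Squarefree (1 + 6 * M * U * j) ∧
        Squarefree (2 * U ^ 3 - M * (1 + 6 * M * U * j)))).card := by
  have hM2 : M % 2 = 1 := Nat.odd_iff.mp hM
  obtain ⟨B, hB⟩ : ∃ B, B = M * 2 ^ (3 * n + 32) := ⟨_, rfl⟩
  have hB1 : 1 ≤ B := by rw [hB]; exact Nat.mul_pos (by omega) (Nat.two_pow_pos _)
  have h6 : 6 * M * 2 ^ (3 * n + 32) = 6 * B := by rw [hB]; ring
  rw [h6] at hU
  -- the two signs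
  have hcase : (M % 3 = 2 ∧ U + 1 = 6 * B) ∨ (M % 3 ≠ 2 ∧ U = 6 * B + 1) := by
    by_cases h3 : M % 3 = 2
    · rw [if_pos h3] at hU
      exact Or.inl ⟨h3, by omega⟩
    · rw [if_neg h3] at hU
      exact Or.inr ⟨h3, hU⟩
  clear hU
  have hU2 : U % 2 = 1 := by omega
  have hUlo : 5 * (M * 2 ^ (3 * n + 32)) ≤ U := by rw [← hB]; omega
  have hUhi : U ≤ 6 * (M * 2 ^ (3 * n + 32)) + 1 := by rw [← hB]; omega
  have hmod := cubeD_two_cube_mod_three U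
  have hU3 : (2 * U ^ 3) % 3 ≠ M % 3 := by
    rcases hcase with ⟨h3, hU⟩ | ⟨h3, hU⟩
    · have hU3 : U % 3 = 2 := by omega
      rw [hU3] at hmod
      norm_num at hmod
      omega
    · have hU3 : U % 3 = 1 := by omega
      rw [hU3] at hmod
      norm_num at hmod
      omega
  have hUM : Nat.Coprime U M := by
    apply Nat.coprime_of_dvd
    intro p hp hpU hpM
    have h6B : p ∣ 6 * B := by
      rw [hB]
      exact Dvd.dvd.mul_left (Dvd.dvd.mul_right hpM _) 6
    rcases hcase with ⟨_, hU⟩ | ⟨_, hU⟩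
    · rw [← hU] at h6B
      exact hp.not_dvd_one ((Nat.dvd_add_right hpU).mp h6B)
    · rw [hU] at hpU
      exact hp.not_dvd_one ((Nat.dvd_add_right h6B).mp hpU)
  obtain ⟨hbig, hsqrt⟩ := cubeD_sizes (by omega) hMn hUlo hUhi
  exact cubeD_count (Nat.two_pow_pos _) hM2 hU2 hU3 hUM hbig hsqrt

/-- **STUB D · `stub_cubeDensity`.** For odd `M < 2ⁿ` (any `n`; we take `n₀ := 0`) and
`U := 6M·2^(3n+32) ∓ 1` (sign `−` iff `M ≡ 2 (mod 3)`), at least a quarter of the seeds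
`j < 2^(6n+60)` have `M s ≤ U³` and both `s := 1 + 6MU j` and `2U³ − M s` squarefree (from the
landed AP squarefree sieve `stub_apSieve` at `p₀ = 5` on the progressions `1 + (6MU) j` and, after
`j ↦ K − 1 − j`, `(2U³ − M − 6M²U(K−1)) + (6M²U) i`). -/
theorem stub_cubeDensity :
    ∃ n₀ : ℕ, ∀ n, n₀ ≤ n → ∀ M : ℕ, Odd M → M < 2 ^ n →
      let U := if M % 3 = 2 then 6 * M * 2 ^ (3 * n + 32) - 1 else 6 * M * 2 ^ (3 * n + 32) + 1
      2 ^ (6 * n + 60) ≤ 4 * ((Finset.range (2 ^ (6 * n + 60))).filter (fun j =>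
        M * (1 + 6 * M * U * j) ≤ U ^ 3 ∧ Squarefree (1 + 6 * M * U * j) ∧
          Squarefree (2 * U ^ 3 - M * (1 + 6 * M * U * j)))).card :=
  ⟨0, fun n _ M hM hMn => cubeD_density_of_eq n M _ hM hMn rfl⟩

end Summit.QuantumAdvantage.QuantumAdvantage.Theorems.IqThreeNotBPP
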